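import Mathlib
import HarnessLib

/-!
# The Katz–Pavlović lattice shock cannot be monotone: the linearised upstream equation has no real decaying mode
# (helper file for the crux `SubOnsagerCeiling.ForwardTailCeilingKP`, stmt-NavierStokesRegularity-27057, `--supports`)

The registered stubs `stub_primaryGradedLargeRatio` / `stub_primaryGradedSmallRatio` of the LEAD skeleton
`Cruxes/ForwardTailCeilingKP/Lines/kp_shell_barrier.lean` contain the ν-uniform `θ`-shell barrier (`θ > 1/2`) of the positive
Katz–Pavlović chain `ẋ_k = Λ^{k-1} x_{k-1}² − Λ^k x_k x_{k+1}` (`Λ = b^{5/2}`) at EVERY scale ratio `b = 1+ε₀ ∈ (1, 2]`; the repair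
census of the hands (item (A′), memo FRONT-TRANSPORT-leafhand4-g9 on the item, `Theorems/SubOnsagerCeilingKPChainFirstOvershoot.lean`)
reads the small-ratio end `b ↓ 1` as a NO-OVERSHOOT question for the DISCRETE FRONT of the shell-energy conservation law.

The inner problem of that front (coefficients frozen over the width of the front, which is legitimate exactly when `b^{5/2} − 1` is
small) is the UNIFORM lattice `ẏ_j = y_{j-1}² − y_j y_{j+1}` invading the empty state from an upstream state `u > 0`.  A travelling
shock `y_j(t) = Y(j − ct)` must have the conservation (Rankine–Hugoniot) speed `c = 2u` (energy density `½u²` advected at speed `c`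
equals the bond flux `u³`; `kpShock_speed`), and its approach to the upstream state is governed by the linearisation
`Y = u + η`, `−c η′(z) = 2u η(z−1) − u η(z) − u η(z+1)`.  An exponential mode `η(z) = e^{μ z}` solves it iff
`χ(μ) := 2e^{−μ} − 1 − e^{μ} + 2μ = 0` (`kpShock_expMode_iff`).  This file proves, def-free:

* `kpShock_charFn_deriv_neg`, `kpShock_charFn_strictAnti` — `χ′(μ) = −2e^{−μ} − e^{μ} + 2 < 0` everywhere
  (`e^{μ}·(−χ′(μ)) = (e^{μ} − 1)² + 1`), so `χ` is strictly decreasing on `ℝ`;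
* `kpShock_charFn_eq_zero_iff` — hence `χ(μ) = 0 ↔ μ = 0`: the ONLY real exponential mode is the constant (translation) mode;
* `kpShock_no_real_decaying_mode` — packaging: a real exponential mode of the linearised shock equation (at any one `z`, `u ≠ 0`)
  has `μ = 0`.  So a KP lattice shock can relax to its upstream state only through COMPLEX exponents, i.e. it OSCILLATES about —
  and therefore overshoots — the upstream (rarefaction-fan) value at every ratio near `1`.

Measured companion numbers (this hand, memo KP-LATTICE-SHOCK-leafhand4-g13.md on the item; pure-python RK4 of the uniform lattice
fed by a held upstream state, 200–260 sites, dt = 0.01 / 0.004): speed `c = 2.0000 u`; universal overshoot factor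
`A := max_{j,t} y_j / u = 1.4007` (site-independent from site 40 on; dt-converged to 1e-5); leading upstream mode
`μ = 0.5398 ± 1.4255 i` (damping `0.583` per site, period `4.41` sites), matching the computed wake.  Reading for census item (A′):
at the `b ↓ 1` end the chain's per-shell peaks are `A`× the continuum rarefaction-fan value at the shock, i.e. Kolmogorov-scaled
(`θ_f → 5/6`); in the K41 currency `b^{5k/6} x_k` the late-front level is `≈ A·√(5 ln b)·(1 − b^{−5k/3})`, below the datum level
`1` iff `b ≲ exp(1/(5A²)) ≈ 1.107` (adiabatic estimate; the measured `(5/6, D = 1)` range of hands 4-g2/4-g8 is `b ≤ 1.03`).  So the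
analytic small-ratio theorem is an ADIABATIC-SHOCK (modulation) statement with small parameter `(b^{5/2} − 1)/Re μ ≈ 4.6 ε₀` and an
`O(1)` margin at the `b ↓ 1` end — not a monotonicity / maximum-principle statement, which the oscillatory tail forbids.
HONEST FRAMING: elementary real analysis motivated by a MODEL lattice ODE (route SubOnsagerCeiling, rung TL-M2Break); no stub, crux
or summit is proved here and nothing in this file bears on Navier–Stokes regularity.
[cite: Tao2016AveragedNS, §4 (4.13)] [cite: BarbatoMorandinRomito2011, §2 (the chain)]
-/

noncomputable section

-- the sub-problem namespace `NavierStokesRegularity.NavierStokesRegularity` is the tree's layout (D-0017)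
set_option linter.dupNamespace false

namespace Summit.NavierStokesRegularity.NavierStokesRegularity.Theorems

open Real

/-- **Rankine–Hugoniot speed of the KP lattice shock.** A front advancing at speed `c` into the empty state while carrying
the upstream energy density `½u²` delivers energy at rate `c·½u²`; the bond flux of the uniform upstream state is `u²·u`.
Equality of the two forces `c = 2u` (`u ≠ 0`). [this file] -/
theorem kpShock_speed {u c : ℝ} (hu : u ≠ 0) : c * ((1 / 2 : ℝ) * u ^ 2) = u ^ 2 * u ↔ c = 2 * u := by
  have hu2 : u ^ 2 ≠ 0 := pow_ne_zero 2 hu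
  constructor
  · intro h
    have h' : (c - 2 * u) * u ^ 2 = 0 := by nlinarith [h]
    rcases mul_eq_zero.1 h' with h1 | h1
    · linarith
    · exact absurd h1 hu2
  · rintro rfl
    ring

/-- The characteristic function `χ(μ) = 2e^{−μ} − 1 − e^{μ} + 2μ` of the linearised KP shock equation has derivative
`−2e^{−μ} − e^{μ} + 2` at every `μ`. [this file] -/
theorem kpShock_charFn_hasDerivAt (x : ℝ) :
    HasDerivAt (fun μ : ℝ => 2 * exp (-μ) - 1 - exp μ + 2 * μ) (-2 * exp (-x) - exp x + 2) x := by
  have h1 : HasDerivAt (fun μ : ℝ => exp (-μ)) (exp (-x) * (-1)) x := by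
    have hneg : HasDerivAt (fun μ : ℝ => -μ) (-1) x := hasDerivAt_neg x
    exact hneg.exp
  have h2 : HasDerivAt (fun μ : ℝ => exp μ) (exp x) x := hasDerivAt_exp x
  have h3 : HasDerivAt (fun μ : ℝ => 2 * μ) (2 * 1) x := (hasDerivAt_id x).const_mul 2
  have h := (((h1.const_mul 2).sub_const 1).sub h2).add h3
  refine h.congr_deriv ?_
  ring

/-- **`χ′ < 0` everywhere**: `−2e^{−x} − e^{x} + 2 < 0`, because `e^{x}·(2e^{−x} + e^{x} − 2) = (e^{x} − 1)² + 1 > 0`. [this file] -/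
theorem kpShock_charFn_deriv_neg (x : ℝ) : -2 * exp (-x) - exp x + 2 < 0 := by
  have he : 0 < exp x := exp_pos x
  have he' : 0 < exp (-x) := exp_pos (-x)
  have hee' : exp x * exp (-x) = 1 := by rw [← exp_add, add_neg_cancel, exp_zero]
  have key : (2 * exp (-x) + exp x - 2) * exp x = (exp x - 1) ^ 2 + 1 := by nlinarith [hee']
  have hpos : 0 < (2 * exp (-x) + exp x - 2) * exp x := by rw [key]; positivity
  have : 0 < 2 * exp (-x) + exp x - 2 := (pos_iff_pos_of_mul_pos hpos).mpr he
  linarith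

/-- The derivative of `χ` in `deriv` form. [this file] -/
theorem kpShock_charFn_deriv (x : ℝ) :
    deriv (fun μ : ℝ => 2 * exp (-μ) - 1 - exp μ + 2 * μ) x = -2 * exp (-x) - exp x + 2 :=
  (kpShock_charFn_hasDerivAt x).deriv

/-- **`χ` is strictly decreasing on `ℝ`.** [this file] -/
theorem kpShock_charFn_strictAnti : StrictAnti (fun μ : ℝ => 2 * exp (-μ) - 1 - exp μ + 2 * μ) := by
  apply strictAnti_of_deriv_neg
  intro x
  rw [kpShock_charFn_deriv]
  exact kpShock_charFn_deriv_neg x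

/-- **The only real zero of `χ` is `μ = 0`** (the translation mode). [this file] -/
theorem kpShock_charFn_eq_zero_iff (μ : ℝ) : 2 * exp (-μ) - 1 - exp μ + 2 * μ = 0 ↔ μ = 0 := by
  have hf0 : (fun μ : ℝ => 2 * exp (-μ) - 1 - exp μ + 2 * μ) 0 = 0 := by norm_num
  constructor
  · intro h
    exact kpShock_charFn_strictAnti.injective (h.trans hf0.symm)
  · rintro rfl
    norm_num

/-- `χ > 0` to the left of `0` and `χ < 0` to the right (sign pattern of a strictly decreasing function vanishing at `0`).
[this file] -/
theorem kpShock_charFn_sign (μ : ℝ) :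
    (μ < 0 → 0 < 2 * exp (-μ) - 1 - exp μ + 2 * μ) ∧ (0 < μ → 2 * exp (-μ) - 1 - exp μ + 2 * μ < 0) := by
  have h0 : (fun μ : ℝ => 2 * exp (-μ) - 1 - exp μ + 2 * μ) 0 = 0 := by norm_num
  refine ⟨fun hμ => ?_, fun hμ => ?_⟩
  · have h1 := kpShock_charFn_strictAnti hμ
    rw [h0] at h1
    exact h1
  · have h1 := kpShock_charFn_strictAnti hμ
    rw [h0] at h1
    exact h1

/-- **Exponential modes of the linearised KP shock equation.** With the Rankine–Hugoniot speed `c = 2u` (`u ≠ 0`), the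
ansatz `η(z) = e^{μ z}` satisfies the linearised upstream equation `−c η′(z) = 2u η(z−1) − u η(z) − u η(z+1)` at a point `z`
iff `χ(μ) = 0` (the factor `u e^{μz} ≠ 0` divides out). [this file] -/
theorem kpShock_expMode_iff {u : ℝ} (hu : u ≠ 0) (μ z : ℝ) :
    -(2 * u) * (μ * exp (μ * z)) = 2 * u * exp (μ * (z - 1)) - u * exp (μ * z) - u * exp (μ * (z + 1)) ↔
      2 * exp (-μ) - 1 - exp μ + 2 * μ = 0 := by
  have hz : 0 < exp (μ * z) := exp_pos _
  have hm1 : exp (μ * (z - 1)) = exp (μ * z) * exp (-μ) := by rw [← exp_add]; ring_nf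
  have hp1 : exp (μ * (z + 1)) = exp (μ * z) * exp μ := by rw [← exp_add]; ring_nf
  rw [hm1, hp1]
  have huz : u * exp (μ * z) ≠ 0 := mul_ne_zero hu hz.ne'
  constructor
  · intro h
    have h' : (u * exp (μ * z)) * (2 * exp (-μ) - 1 - exp μ + 2 * μ) = 0 := by nlinarith [h]
    rcases mul_eq_zero.1 h' with h1 | h1
    · exact absurd h1 huz
    · exact h1
  · intro h
    have h' : (u * exp (μ * z)) * (2 * exp (-μ) - 1 - exp μ + 2 * μ) = 0 := by rw [h, mul_zero]
    nlinarith [h']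

/-- **No real decaying mode.** If a real exponential `e^{μz}` solves the linearised KP shock equation (speed `2u`, `u ≠ 0`) at
some point, then `μ = 0`: the approach of a KP lattice shock to its upstream state cannot be through a real (monotone) exponential
tail — the relaxation is oscillatory, so the shock overshoots the upstream value. [this file] -/
theorem kpShock_no_real_decaying_mode {u : ℝ} (hu : u ≠ 0) {μ z : ℝ}
    (h : -(2 * u) * (μ * exp (μ * z)) = 2 * u * exp (μ * (z - 1)) - u * exp (μ * z) - u * exp (μ * (z + 1))) :
    μ = 0 :=
  (kpShock_charFn_eq_zero_iff μ).1 ((kpShock_expMode_iff hu μ z).1 h)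

end Summit.NavierStokesRegularity.NavierStokesRegularity.Theorems

end
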